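import Mathlib.Data.Fintype.Card
import Mathlib.Data.Finset.Card
import Mathlib.Data.Nat.Choose.Basic
import Mathlib.Algebra.Order.Ring.Nat
import HarnessLib

/-!
# Counting the generators of an up-set: two finite antichains generating the same up-set have
# the same size

Topic: `Literature/AlgebraicGeometry/Resolution` (bookkeeping for the intrinsic count of charged
components in the exceptionalisation game of `CleanModelsSuffice`, route `RadicialJung`: the germ
of the normalisation-singular locus at a point is the union of the closures of finitely many
pairwise incomparable generisations, and their NUMBER does not depend on the presentation). For a
transitive antisymmetric relation `r` (think: "generises", `η ⤳ w`) and a set `G`: if two finite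
families `ζ, ζ'` of members of `G` are antichains for `r` and each `r`-dominates every element of
`G`, then they have the same cardinality (indeed the same range: the `r`-minimal elements of `G`).
Everything is PROVED:

* `exists_eq_of_forall_exists_of_antichain` — every `ζ i` is some `ζ' i'`;
* `card_eq_of_forall_exists_of_antichain` — `|ι| = |ι'|`;
* `Nat.choose_two_lt_choose_two`, `Nat.eq_of_choose_two_eq` — `n ↦ C(n, 2)` is injective on
  `n ≥ 1` (used to pass from counting pairs to counting elements).

## Sources

Folklore (minimal elements of a finitely generated up-set in a poset). [folklore]
-/

namespace Literature.AlgebraicGeometry.Resolution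

universe u v w

section Antichain

variable {α : Type u} {ι : Type v} {ι' : Type w} (r : α → α → Prop)
  (htrans : ∀ a b c, r a b → r b c → r a c) (hanti : ∀ a b, r a b → r b a → a = b)
  (G : Set α) (ζ : ι → α) (ζ' : ι' → α)
  (hζG : ∀ i, ζ i ∈ G) (hζ : ∀ x ∈ G, ∃ i, r (ζ i) x) (haζ : ∀ i j, r (ζ i) (ζ j) → i = j)
  (hζ'G : ∀ i', ζ' i' ∈ G) (hζ' : ∀ x ∈ G, ∃ i', r (ζ' i') x)

include htrans hanti hζG hζ haζ hζ'G hζ' in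
/-- If the antichain `ζ ⊆ G` and the family `ζ' ⊆ G` both dominate `G`, every `ζ i` equals some
`ζ' i'`. [folklore] -/
theorem exists_eq_of_forall_exists_of_antichain (i : ι) : ∃ i', ζ' i' = ζ i := by
  obtain ⟨i', hi'⟩ := hζ' (ζ i) (hζG i)
  obtain ⟨j, hj⟩ := hζ (ζ' i') (hζ'G i')
  have hji : j = i := haζ j i (htrans _ _ _ hj hi')
  subst hji
  exact ⟨i', hanti _ _ hi' hj⟩

include htrans hanti hζG hζ haζ hζ'G hζ' in
/-- **Two finite antichains of `G` dominating `G` have the same cardinality** (both enumerate the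
`r`-minimal elements of `G`). [folklore] -/
theorem card_eq_of_forall_exists_of_antichain [Fintype ι] [Fintype ι']
    (haζ' : ∀ i j, r (ζ' i) (ζ' j) → i = j) (hrefl : ∀ i, r (ζ i) (ζ i))
    (hrefl' : ∀ i', r (ζ' i') (ζ' i')) : Fintype.card ι = Fintype.card ι' := by
  classical
  have hinj : Function.Injective ζ := fun i j h => haζ i j (h ▸ hrefl j)
  have hinj' : Function.Injective ζ' := fun i j h => haζ' i j (h ▸ hrefl' j)
  have hrange : Finset.univ.image ζ = Finset.univ.image ζ' := by
    ext x
    simp only [Finset.mem_image, Finset.mem_univ, true_and]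
    constructor
    · rintro ⟨i, rfl⟩
      exact exists_eq_of_forall_exists_of_antichain r htrans hanti G ζ ζ' hζG hζ haζ hζ'G hζ' i
    · rintro ⟨i', rfl⟩
      exact exists_eq_of_forall_exists_of_antichain r htrans hanti G ζ' ζ hζ'G hζ' haζ' hζG hζ i'
  rw [← Finset.card_univ, ← Finset.card_image_of_injective Finset.univ hinj, hrange,
    Finset.card_image_of_injective Finset.univ hinj', Finset.card_univ]

end Antichain

/-- `n ↦ C(n, 2)` is strictly increasing on `n ≥ 1`. [folklore] -/
theorem Nat.choose_two_lt_choose_two {m n : ℕ} (hm : 1 ≤ m) (hmn : m < n) :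
    m.choose 2 < n.choose 2 := by
  induction n with
  | zero => exact absurd hmn (Nat.not_lt_zero _)
  | succ n ih =>
    rw [Nat.choose_succ_succ, Nat.choose_one_right, Nat.add_comm]
    rcases Nat.lt_succ_iff_lt_or_eq.mp hmn with h | h
    · exact Nat.lt_add_right n (ih h)
    · subst h
      exact Nat.lt_add_of_pos_right hm

/-- `C(m, 2) = C(n, 2)` with `m, n ≥ 1` forces `m = n`. [folklore] -/
theorem Nat.eq_of_choose_two_eq {m n : ℕ} (hm : 1 ≤ m) (hn : 1 ≤ n)
    (h : m.choose 2 = n.choose 2) : m = n := by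
  rcases lt_trichotomy m n with hlt | heq | hgt
  · exact absurd h (Nat.choose_two_lt_choose_two hm hlt).ne
  · exact heq
  · exact absurd h (Nat.choose_two_lt_choose_two hn hgt).ne'

end Literature.AlgebraicGeometry.Resolution
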